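import Summits.Parity.GeneralizedHardyLittlewood.Theorems.LiouvilleShiftedTablesSieveToMAvgI2PerQ

/-!
# Sieve glue for `SieveToMAvg`, part 7f: Type I₂ — the bound for a triple product

Support file for item stmt-Parity-14274 (route `LiouvilleShiftedTables`).  Summing the per-modulus
bound of part 7e over `q ≤ Q`, `(q, h) = 1`, with the corner bound of part 7d (the crux `TypeI2Dilated`
at scale `X`) and the elementary count of the thin sets (part 7a) gives `TT_triple_le`:

  `TT(γ ⋆ 𝟙_{(s₁,s₂]} ⋆ 𝟙_{(n₁,n₂]}) ≤ 4 K_s √K_r · √(2x H_Q H_{s₂} ∑ γ²/r + s₂ Q ∑ γ²) · √(C₂X/(log X)^A)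
      + ‖γ‖₁ s₂ ((((1+Δ)²−1)(n₁+n₂) + 2) H_Q + 2Q)`.
-/

namespace Summit.Parity.GeneralizedHardyLittlewood.Theorems.SieveToMAvg

open Finset Real
open scoped ArithmeticFunction.zeta ArithmeticFunction.sigma
open Literature.NumberTheory.Sieve.BFI

section Final

variable {h Q : ℕ} {x X Δ R ρ' A C₂ : ℝ} {γ : ArithmeticFunction ℝ} {s₁ s₂ n₁ n₂ : ℝ}

/-- The thin-set count summed over the moduli: for any `m`,
`∑_{q ≤ Q, (q,h)=1} thinCount(q, m) ≤ (((1+Δ)²−1)(n₁+n₂) + 2) H_Q + 2Q` (`0 ≤ n₁, n₂`, `0 ≤ Δ`). [folklore] -/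
theorem sum_moduli_thinCount_le (hΔ : 0 ≤ Δ) (hn₁ : 0 ≤ n₁) (hn₂ : 0 ≤ n₂) (m : ℕ) :
    ∑ q ∈ moduli Q h, thinCount h q Δ n₁ n₂ m ≤
      (((1 + Δ) ^ 2 - 1) * (n₁ + n₂) + 2) * Hsum Q + 2 * Q := by
  unfold thinCount thin₁ thin₂
  rw [Finset.sum_add_distrib]
  have hD : 1 ≤ (1 + Δ) ^ 2 := by nlinarith
  have hfl1 : ⌊n₁⌋₊ ≤ ⌊(1 + Δ) ^ 2 * n₁⌋₊ := Nat.floor_le_floor (by nlinarith)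
  have hfl2 : ⌊n₂ / (1 + Δ) ^ 2⌋₊ ≤ ⌊n₂⌋₊ := Nat.floor_le_floor (div_le_self hn₂ hD)
  have h1 := sum_moduli_card_filter_le Q h m hfl1
  have h2 := sum_moduli_card_filter_le Q h m hfl2
  rw [← Hsum_natCast] at h1 h2
  have hHQ := Hsum_nonneg (Q : ℝ)
  -- lengths of the thin sets
  have hT1 : (⌊(1 + Δ) ^ 2 * n₁⌋₊ : ℝ) - ⌊n₁⌋₊ ≤ ((1 + Δ) ^ 2 - 1) * n₁ + 1 := by
    have ha : (⌊(1 + Δ) ^ 2 * n₁⌋₊ : ℝ) ≤ (1 + Δ) ^ 2 * n₁ := Nat.floor_le (by positivity)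
    have hb : n₁ < (⌊n₁⌋₊ : ℝ) + 1 := Nat.lt_floor_add_one n₁
    linarith
  have hT2 : (⌊n₂⌋₊ : ℝ) - ⌊n₂ / (1 + Δ) ^ 2⌋₊ ≤ ((1 + Δ) ^ 2 - 1) * n₂ + 1 := by
    have ha : (⌊n₂⌋₊ : ℝ) ≤ n₂ := Nat.floor_le hn₂
    have hb : n₂ / (1 + Δ) ^ 2 < (⌊n₂ / (1 + Δ) ^ 2⌋₊ : ℝ) + 1 := Nat.lt_floor_add_one _
    have hc : n₂ - n₂ / (1 + Δ) ^ 2 ≤ ((1 + Δ) ^ 2 - 1) * n₂ := by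
      rw [show n₂ - n₂ / (1 + Δ) ^ 2 = n₂ * (((1 + Δ) ^ 2 - 1) / (1 + Δ) ^ 2) by field_simp]
      rw [show ((1 + Δ) ^ 2 - 1) * n₂ = n₂ * ((1 + Δ) ^ 2 - 1) by ring]
      refine mul_le_mul_of_nonneg_left (div_le_self (by linarith) hD) hn₂
    linarith
  calc (∑ q ∈ moduli Q h, ((((Ioc ⌊n₁⌋₊ ⌊(1 + Δ) ^ 2 * n₁⌋₊).filter (fun n => m * n ≡ h [MOD q])).card : ℕ) : ℝ)) +
        ∑ q ∈ moduli Q h, ((((Ioc ⌊n₂ / (1 + Δ) ^ 2⌋₊ ⌊n₂⌋₊).filter (fun n => m * n ≡ h [MOD q])).card : ℕ) : ℝ)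
      ≤ (((⌊(1 + Δ) ^ 2 * n₁⌋₊ : ℝ) - ⌊n₁⌋₊) * Hsum Q + Q) + (((⌊n₂⌋₊ : ℝ) - ⌊n₂ / (1 + Δ) ^ 2⌋₊) * Hsum Q + Q) :=
        add_le_add h1 h2
    _ ≤ ((((1 + Δ) ^ 2 - 1) * n₁ + 1) * Hsum Q + Q) + ((((1 + Δ) ^ 2 - 1) * n₂ + 1) * Hsum Q + Q) := by
        gcongr
    _ = (((1 + Δ) ^ 2 - 1) * (n₁ + n₂) + 2) * Hsum Q + 2 * Q := by ring

/-- `∑_{s ≤ 2x} indAF s₁ s₂ s ≤ s₂` (`s₂ ≥ 0`). [folklore] -/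
theorem sum_indAF_le (hs₂ : 0 ≤ s₂) : ∑ s ∈ Ioc 0 ⌊2 * x⌋₊, indAF s₁ s₂ s ≤ s₂ := by
  classical
  calc ∑ s ∈ Ioc 0 ⌊2 * x⌋₊, indAF s₁ s₂ s
      ≤ ∑ s ∈ Ioc 0 ⌊2 * x⌋₊, (if s ∈ Ioc 0 ⌊s₂⌋₊ then (1 : ℝ) else 0) := by
        refine Finset.sum_le_sum fun s hs => ?_
        rw [indAF_apply]
        split_ifs with h1 h2
        · exact le_rfl
        · exfalso; apply h2
          rw [Finset.mem_Ioc]; exact ⟨h1.1, Nat.le_floor h1.2.2⟩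
        · exact zero_le_one
        · exact le_rfl
    _ = (((Ioc 0 ⌊2 * x⌋₊).filter (fun s => s ∈ Ioc 0 ⌊s₂⌋₊)).card : ℝ) := by
        rw [← Finset.sum_filter, Finset.sum_const, nsmul_eq_mul, mul_one]
    _ ≤ ((Ioc 0 ⌊s₂⌋₊).card : ℝ) := by
        exact_mod_cast Finset.card_le_card (fun s hs => (Finset.mem_filter.1 hs).2)
    _ ≤ s₂ := by rw [Nat.card_Ioc, Nat.sub_zero]; exact Nat.floor_le hs₂

/-- **Type I₂: the bound for a triple product.**  See the module docstring; hypotheses: the crux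
at scale `X` (`HypI2`), `0 < x`, `2x ≤ X`, `0 < Δ ≤ 1`, `γ` supported on `r ≤ R` with
`1 ≤ R ≤ min(X^ρ', 2x)`, `R < (1+Δ)^{K_r}`, `0 < s₂ ≤ 2x`, `s₂ < (1+Δ)^{K_s}`, `s₂ R ≤ X^{1/2+ρ'}`,
`0 ≤ n₁ ≤ n₂`, `Q ≤ ⌊X^ρ'⌋`. [folklore] -/
theorem TT_triple_le (hyp : HypI2 X (-(h : ℤ)) h ρ' A C₂) (hx : 0 < x) (hxX : 2 * x ≤ X)
    (hΔ : 0 < Δ) {K_r : ℕ} (hR1 : 1 ≤ R) (hRX : R ≤ X ^ ρ') (hRx : R ≤ 2 * x)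
    (hKr : R < (1 + Δ) ^ K_r) (hγ : ∀ r : ℕ, γ r ≠ 0 → (r : ℝ) ≤ R) (hs₂ : 0 < s₂)
    (hs₂x : s₂ ≤ 2 * x) {K_s : ℕ} (hKs : s₂ < (1 + Δ) ^ K_s) (hsR : s₂ * R ≤ X ^ (1 / 2 + ρ'))
    (hn₁ : 0 ≤ n₁) (hn₁₂ : n₁ ≤ n₂) (hQ : Q ≤ ⌊X ^ ρ'⌋₊) :
    TT (lamW h) h Q x (fun n => (γ * indAF s₁ s₂ * indAF n₁ n₂) n) ≤
      4 * K_s * Real.sqrt K_r *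
        Real.sqrt (2 * x * Hsum Q * Hsum s₂ * (∑ r ∈ Ioc 0 ⌊2 * x⌋₊, γ r ^ 2 / r) +
          s₂ * Q * ∑ r ∈ Ioc 0 ⌊2 * x⌋₊, γ r ^ 2) * Real.sqrt (C₂ * X / Real.log X ^ A) +
      (∑ r ∈ Ioc 0 ⌊2 * x⌋₊, |γ r|) * s₂ * ((((1 + Δ) ^ 2 - 1) * (n₁ + n₂) + 2) * Hsum Q + 2 * Q) := by
  set N := ⌊2 * x⌋₊ with hN
  have hR : 0 < R := by linarith
  have hn₂ : 0 ≤ n₂ := hn₁.trans hn₁₂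
  set Ψ := Real.sqrt (C₂ * X / Real.log X ^ A) with hΨ
  set V : ℕ → ℝ := fun ρ => 2 * x * Hsum Q * Hsum s₂ * (∑ r ∈ Ioc 0 N, boxRestrict R Δ ρ γ r ^ 2 / r) +
    s₂ * Q * ∑ r ∈ Ioc 0 N, boxRestrict R Δ ρ γ r ^ 2 with hV
  set Θ := (((1 + Δ) ^ 2 - 1) * (n₁ + n₂) + 2) * Hsum Q + 2 * Q with hΘ
  have hΨ0 : 0 ≤ Ψ := Real.sqrt_nonneg _
  have hV0 : ∀ ρ, 0 ≤ V ρ := by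
    intro ρ
    have h1 := Hsum_nonneg (Q : ℝ); have h2 := Hsum_nonneg s₂
    have h3 : 0 ≤ ∑ r ∈ Ioc 0 N, boxRestrict R Δ ρ γ r ^ 2 / r :=
      Finset.sum_nonneg fun r _ => by positivity
    have h4 : 0 ≤ ∑ r ∈ Ioc 0 N, boxRestrict R Δ ρ γ r ^ 2 := Finset.sum_nonneg fun r _ => sq_nonneg _
    positivity
  -- supports of the pieces
  have hγρ : ∀ ρ, ∀ r : ℕ, boxRestrict R Δ ρ γ r ≠ 0 → (r : ℝ) ≤ R :=
    fun ρ r hr => hγ r (boxRestrict_ne_zero hr).2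
  -- corners
  have hcorner : ∀ ρ : ℕ, ∀ S y : ℝ, 0 ≤ S → S ≤ s₂ → 0 ≤ y → y ≤ 2 * x →
      ∑ q ∈ moduli Q h, ∑ r ∈ Ioc 0 N, |boxRestrict R Δ ρ γ r| * |Dsum h q r S y| ≤ Real.sqrt (V ρ) * Ψ := by
    intro ρ S y hS0 hS hy0 hy
    exact corner_le hyp hx hxX hR1 hRX hRx hQ (hγρ ρ) hS0 hS hsR hy0 hy
  -- bounds on the corner parameters
  have hΔ' : (-1 : ℝ) < Δ := by linarith
  have hSB : ∀ i, 0 ≤ sB s₂ Δ i ∧ sB s₂ Δ i ≤ s₂ := fun i =>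
    ⟨by unfold sB boxHigh; positivity, by unfold sB boxHigh; exact div_le_self hs₂.le (one_le_pow₀ (by linarith))⟩
  have hSA : ∀ i, 0 ≤ sA s₁ s₂ Δ i ∧ sA s₁ s₂ Δ i ≤ s₂ := fun i =>
    ⟨(boxLow_pos hs₂ hΔ' i).le.trans (boxLow_le_sA hs₂.le hΔ.le i), (sA_le_sB i).trans (hSB i).2⟩
  have hP0 : ∀ ρ i, 0 ≤ P0 Δ R s₁ s₂ ρ i := fun ρ i =>
    mul_nonneg (boxLow_pos hR hΔ' ρ).le (hSA i).1
  have hM : ∀ ρ i, 0 ≤ cutM x (P0 Δ R s₁ s₂ ρ i) n₂ ∧ cutM x (P0 Δ R s₁ s₂ ρ i) n₂ ≤ 2 * x := fun ρ i =>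
    ⟨le_min (by linarith) (mul_nonneg (hP0 ρ i) hn₂), cutM_le⟩
  have hL : ∀ ρ i, 0 ≤ cutL x Δ (P0 Δ R s₁ s₂ ρ i) n₁ n₂ ∧ cutL x Δ (P0 Δ R s₁ s₂ ρ i) n₁ n₂ ≤ 2 * x := fun ρ i =>
    ⟨cutL_nonneg hx.le (mul_nonneg (hP0 ρ i) hn₂), cutL_le_cutM.trans (hM ρ i).2⟩
  -- the main part for each `(ρ, i)`
  have hD4 : ∀ ρ i, ∑ q ∈ moduli Q h, ∑ r ∈ Ioc 0 N, |boxRestrict R Δ ρ γ r| * D4 h q x Δ R s₁ s₂ n₁ n₂ ρ i r ≤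
      4 * (Real.sqrt (V ρ) * Ψ) := by
    intro ρ i
    have e : ∀ q r, |boxRestrict R Δ ρ γ r| * D4 h q x Δ R s₁ s₂ n₁ n₂ ρ i r =
        |boxRestrict R Δ ρ γ r| * |Dsum h q r (sB s₂ Δ i) (cutM x (P0 Δ R s₁ s₂ ρ i) n₂)| +
        |boxRestrict R Δ ρ γ r| * |Dsum h q r (sA s₁ s₂ Δ i) (cutM x (P0 Δ R s₁ s₂ ρ i) n₂)| +
        |boxRestrict R Δ ρ γ r| * |Dsum h q r (sB s₂ Δ i) (cutL x Δ (P0 Δ R s₁ s₂ ρ i) n₁ n₂)| +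
        |boxRestrict R Δ ρ γ r| * |Dsum h q r (sA s₁ s₂ Δ i) (cutL x Δ (P0 Δ R s₁ s₂ ρ i) n₁ n₂)| := by
      intro q r; unfold D4; ring
    simp only [e, Finset.sum_add_distrib]
    have c1 := hcorner ρ _ _ (hSB i).1 (hSB i).2 (hM ρ i).1 (hM ρ i).2
    have c2 := hcorner ρ _ _ (hSA i).1 (hSA i).2 (hM ρ i).1 (hM ρ i).2
    have c3 := hcorner ρ _ _ (hSB i).1 (hSB i).2 (hL ρ i).1 (hL ρ i).2
    have c4 := hcorner ρ _ _ (hSA i).1 (hSA i).2 (hL ρ i).1 (hL ρ i).2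
    linarith
  -- assemble
  unfold TT
  calc ∑ q ∈ moduli Q h, |corr (lamW h) h q x fun n => (γ * indAF s₁ s₂ * indAF n₁ n₂) n|
      ≤ ∑ q ∈ moduli Q h, ((∑ ρ ∈ Finset.range K_r, ∑ i ∈ Finset.range K_s, ∑ r ∈ Ioc 0 N,
            |boxRestrict R Δ ρ γ r| * D4 h q x Δ R s₁ s₂ n₁ n₂ ρ i r) +
          ∑ r ∈ Ioc 0 N, |γ r| * ∑ s ∈ Ioc 0 N, indAF s₁ s₂ s * thinCount h q Δ n₁ n₂ (r * s)) :=
        Finset.sum_le_sum fun q _ => abs_corr_triple_le hx hΔ hR hKr hγ hs₂ hs₂x hKs hn₁ hn₁₂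
    _ = (∑ ρ ∈ Finset.range K_r, ∑ i ∈ Finset.range K_s, ∑ q ∈ moduli Q h, ∑ r ∈ Ioc 0 N,
            |boxRestrict R Δ ρ γ r| * D4 h q x Δ R s₁ s₂ n₁ n₂ ρ i r) +
          ∑ r ∈ Ioc 0 N, |γ r| * ∑ s ∈ Ioc 0 N, indAF s₁ s₂ s * ∑ q ∈ moduli Q h, thinCount h q Δ n₁ n₂ (r * s) := by
        rw [Finset.sum_add_distrib]
        congr 1
        · rw [Finset.sum_comm]
          refine Finset.sum_congr rfl fun ρ _ => ?_
          rw [Finset.sum_comm]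
        · rw [Finset.sum_comm]
          refine Finset.sum_congr rfl fun r _ => ?_
          rw [← Finset.mul_sum]
          congr 1
          rw [Finset.sum_comm]
          refine Finset.sum_congr rfl fun s _ => ?_
          rw [Finset.mul_sum]
    _ ≤ (∑ ρ ∈ Finset.range K_r, ∑ _i ∈ Finset.range K_s, 4 * (Real.sqrt (V ρ) * Ψ)) +
          ∑ r ∈ Ioc 0 N, |γ r| * ∑ s ∈ Ioc 0 N, indAF s₁ s₂ s * Θ := by
        refine add_le_add (Finset.sum_le_sum fun ρ _ => Finset.sum_le_sum fun i _ => hD4 ρ i)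
          (Finset.sum_le_sum fun r _ => mul_le_mul_of_nonneg_left
            (Finset.sum_le_sum fun s _ => mul_le_mul_of_nonneg_left ?_ ?_) (abs_nonneg _))
        · exact sum_moduli_thinCount_le hΔ.le hn₁ hn₂ (r * s)
        · rw [indAF_apply]; split_ifs <;> norm_num
    _ = 4 * K_s * Ψ * (∑ ρ ∈ Finset.range K_r, Real.sqrt 1 * Real.sqrt (V ρ)) +
          (∑ r ∈ Ioc 0 N, |γ r|) * (∑ s ∈ Ioc 0 N, indAF s₁ s₂ s) * Θ := by
        rw [Finset.sum_mul, Finset.sum_mul, Finset.mul_sum]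
        congr 1
        · refine Finset.sum_congr rfl fun ρ _ => ?_
          rw [Finset.sum_const, Finset.card_range, nsmul_eq_mul, Real.sqrt_one, one_mul]; ring
        · refine Finset.sum_congr rfl fun r _ => ?_
          rw [← Finset.sum_mul]; ring
    _ ≤ 4 * K_s * Ψ * (Real.sqrt K_r * Real.sqrt (∑ ρ ∈ Finset.range K_r, V ρ)) +
          (∑ r ∈ Ioc 0 N, |γ r|) * s₂ * Θ := by
        have hΘ0 : 0 ≤ Θ := by
          have := Hsum_nonneg (Q : ℝ)
          have hD : 0 ≤ (1 + Δ) ^ 2 - 1 := by nlinarith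
          positivity
        have hγ1 : 0 ≤ ∑ r ∈ Ioc 0 N, |γ r| := Finset.sum_nonneg fun _ _ => abs_nonneg _
        refine add_le_add (mul_le_mul_of_nonneg_left ?_ (by positivity)) ?_
        · have := Real.sum_sqrt_mul_sqrt_le (Finset.range K_r) (fun _ => zero_le_one) (fun ρ => hV0 ρ)
          simpa using this
        · exact mul_le_mul_of_nonneg_right (mul_le_mul_of_nonneg_left (sum_indAF_le hs₂.le) hγ1) hΘ0
    _ = _ := by
        have hVsum : ∑ ρ ∈ Finset.range K_r, V ρ = 2 * x * Hsum Q * Hsum s₂ * (∑ r ∈ Ioc 0 N, γ r ^ 2 / r) +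
            s₂ * Q * ∑ r ∈ Ioc 0 N, γ r ^ 2 := by
          simp only [hV]
          rw [Finset.sum_add_distrib, ← Finset.mul_sum, ← Finset.mul_sum, Finset.sum_comm]
          congr 1
          · congr 1
            refine Finset.sum_congr rfl fun r _ => ?_
            rw [← Finset.sum_div, sum_sq_boxRestrict_eq hR hΔ hKr hγ r]
          · congr 1
            rw [Finset.sum_comm]
            exact Finset.sum_congr rfl fun r _ => sum_sq_boxRestrict_eq hR hΔ hKr hγ r
        rw [hVsum]; ring

end Final

end Summit.Parity.GeneralizedHardyLittlewood.Theorems.SieveToMAvg
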